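import Summits.NavierStokesRegularity.NavierStokesRegularity.Theorems.SoloSalvageDavlatov2020
import Literature.Claims.NS.ClayTorusBridge
import Literature.Analysis.FluidPDE.TorusClassicalNSGalileanBoost
import Literature.Analysis.FunctionSpaces.TorusSobolevNormSmoothProofs
import Literature.Analysis.FunctionSpaces.TorusCalculusProofs
import Literature.Analysis.FunctionSpaces.TorusFourierCalculus
import Literature.Analysis.FunctionSpaces.TorusTestFunction
import Literature.Analysis.FunctionSpaces.TorusSpaceTime
import HarnessLib

/-!
# Solo salvage for claim C76 `Davlatov2020`, part 4: the Clay bridge `ClayDelta`, kernel-discharged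

Continuation of `Theorems/SoloSalvageDavlatov2020.lean` (seat `ns-claims-salvage-p2`). The skeleton
`Literature/Claims/NS/Davlatov2020.lean` types the classical bridge under which the SHAPE of Theorem 4's
conclusion decides Clay (B) as the named delta `ClayDelta` (axes Δ2 viscosity normalisation, Δ5 `C^∞`
bootstrap, Δ6 patching, torus ↔ periodic transport): for every `ν > 0` and every Clay (B) datum `u₀` there
is a torus datum `v₀ ∈ H⁴ ∩ V₁` such that IF for every `T > 0` the problem (2.1)–(2.5) (`f ≡ 0`, `Q₀ = 1`)
has a unique `C¹ₜC²ₓ` classical solution from `v₀` on `[0,T]`, THEN the periodic Clay problem at viscosity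
`ν` is solvable from `u₀`. This file PROVES it (`clayDelta_holds`), with `v₀` the torus descent of
`ν⁻¹u₀` (viscosity normalised to `1` by the amplitude–time rescaling):

* the maximal classical solution `(W, P)` on `𝕋³` at viscosity `1` from `v₀`
  (`Torus.exists_maximal_classicalNS_anyMean`) is either global — then the Clay problem for `ν⁻¹u₀` at
  viscosity `1` is solvable (`clayPeriodic_solvable_zero_iff_torus`), hence the one for `u₀` at viscosity `ν`
  (`ClaySpec.Solvable.of_viscosity`) — or blows up in enstrophy at some `T* < ∞`;
* in the blow-up branch the hypothesis supplies a `C¹ₜC²ₓ` solution `(u, p)` on `[0,T*]` and uniqueness in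
  that class on every window `[0,t]`, `t < T*`; the classical solution, restricted and with its pressure
  renormalised to `∫p = 1`, is in the class (`isC1C2Solution_of_classical`), so `W = u` on `[0,T*)`; but a
  `C¹ₜC²ₓ` field has bounded enstrophy on the compact `[0,T*]` (`gradNormSq_le_of_isC1C2`) — contradiction.

No `C^∞` bootstrap of `C¹C²` solutions is needed: smoothness comes from the maximal classical solution,
the hypothesis is used only through its uniqueness clause. Original sources: RRS 2016 §6.3/§8.1 (maximal
solution, blow-up alternative), Fefferman 2006 (B); not the claim.

WHAT THIS IS NOT: not a claim about NS regularity or blow-up; not a claim about any author beyond the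
typed locator.
-/

noncomputable section

open Set MeasureTheory Filter Function
open scoped ENNReal ContDiff

-- The mandated landing namespace repeats the summit name by design (D-0017).
set_option linter.dupNamespace false

namespace Summit.NavierStokesRegularity.NavierStokesRegularity.Theorems

namespace Davlatov2020

open Literature.Claims.NS.Davlatov2020 Literature.Claims.NS.ClayVariants Literature.Analysis
  Literature.Analysis.FluidPDE Literature.Analysis.FunctionSpaces

/-! ### `C¹ₜC²ₓ` solutions: restriction and bounded enstrophy -/

/-- Restriction of a `C¹ₜC²ₓ` solution of (2.1)–(2.5) to a shorter window `[0,T'] ⊆ [0,T]` (the one-sided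
time derivative within the shorter window agrees with the one within `[0,T]`). [cite: Davlatov2016NSPeriodic, Definition 1 pp. 5–6] -/
theorem isC1C2Solution_mono {T T' Q₀ : ℝ} {f : ℝ → UnitAddTorus (Fin 3) → EuclideanSpace ℝ (Fin 3)}
    {u₀ : UnitAddTorus (Fin 3) → EuclideanSpace ℝ (Fin 3)}
    {u : ℝ → UnitAddTorus (Fin 3) → EuclideanSpace ℝ (Fin 3)} {p : ℝ → UnitAddTorus (Fin 3) → ℝ}
    (hT' : 0 < T') (hle : T' ≤ T) (h : IsC1C2Solution T Q₀ f u₀ u p) :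
    IsC1C2Solution T' Q₀ f u₀ u p := by
  obtain ⟨hC1, hC2, hpc, hp1, heq, hdiv, h0, hQ⟩ := h
  have hsub : Icc 0 T' ⊆ Icc 0 T := Icc_subset_Icc le_rfl hle
  refine ⟨hC1.mono (prod_mono hsub Subset.rfl), fun t ht => hC2 t (hsub ht),
    hpc.mono (prod_mono hsub Subset.rfl), fun t ht => hp1 t (hsub ht), fun t ht x => ?_,
    fun t ht => hdiv t (hsub ht), h0, fun t ht => hQ t (hsub ht)⟩
  have htd : Torus.timeDerivWithin (Icc 0 T') u t x = Torus.timeDerivWithin (Icc 0 T) u t x := by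
    obtain ⟨y, rfl⟩ := Torus.proj_surjective x
    simp only [Torus.timeDerivWithin]
    refine derivWithin_subset hsub (uniqueDiffOn_Icc hT' t ht) ?_
    have hd : DifferentiableWithinAt ℝ (Torus.stLift u) (Icc 0 T ×ˢ univ) (t, y) :=
      hC1.differentiableOn one_ne_zero (t, y) (mk_mem_prod (hsub ht) (mem_univ _))
    exact hd.comp t (differentiableWithinAt_id.prodMk (differentiableWithinAt_const y))
      (fun s hs => mk_mem_prod hs (mem_univ _))
  rw [htd]
  exact heq t (hsub ht) x

/-- **Bounded enstrophy of `C¹ₜC²ₓ` fields**: for a `C¹ₜC²ₓ` solution on `[0,T]` (`T > 0`) the spatial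
partial derivatives are the values `D(stLift u)(t,y)(0,eᵢ)` of the continuous derivative of the `C¹`
space–time lift, hence bounded on `[0,T] × 𝕋³`, and `‖∇u(t)‖₂² ≤ B` on `[0,T]`. [folklore] -/
theorem gradNormSq_le_of_isC1C2 {T Q₀ : ℝ} {f : ℝ → UnitAddTorus (Fin 3) → EuclideanSpace ℝ (Fin 3)}
    {u₀ : UnitAddTorus (Fin 3) → EuclideanSpace ℝ (Fin 3)}
    {u : ℝ → UnitAddTorus (Fin 3) → EuclideanSpace ℝ (Fin 3)} {p : ℝ → UnitAddTorus (Fin 3) → ℝ}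
    (hT : 0 < T) (h : IsC1C2Solution T Q₀ f u₀ u p) :
    ∃ B : ℝ, ∀ t ∈ Icc 0 T, Torus.gradNormSq (u t) ≤ B := by
  obtain ⟨hC1, hC2, -, -, -, -, -, -⟩ := h
  set S : Set (ℝ × EuclideanSpace ℝ (Fin 3)) := Icc 0 T ×ˢ univ with hS
  have hSU : UniqueDiffOn ℝ S := (uniqueDiffOn_Icc hT).prod uniqueDiffOn_univ
  -- partial derivatives through the space–time lift
  have hpd : ∀ i : Fin 3, ∀ t ∈ Icc 0 T, ∀ y : EuclideanSpace ℝ (Fin 3),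
      Torus.partialDeriv i (u t) (Torus.proj y) =
        fderivWithin ℝ (Torus.stLift u) S (t, y) (0, EuclideanSpace.single i 1) := by
    intro i t ht y
    have h1 : HasFDerivWithinAt (Torus.stLift u) (fderivWithin ℝ (Torus.stLift u) S (t, y)) S (t, y) :=
      (hC1.differentiableOn one_ne_zero (t, y) (mk_mem_prod ht (mem_univ _))).hasFDerivWithinAt
    have h2 : HasFDerivAt (fun z : EuclideanSpace ℝ (Fin 3) => ((t, z) : ℝ × EuclideanSpace ℝ (Fin 3)))
        (ContinuousLinearMap.inr ℝ ℝ (EuclideanSpace ℝ (Fin 3))) y := hasFDerivAt_prodMk_right t y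
    have h3 := h1.comp_hasFDerivAt y h2 (Eventually.of_forall fun z => mk_mem_prod ht (mem_univ _))
    have hcomp : (Torus.stLift u ∘ fun z : EuclideanSpace ℝ (Fin 3) => ((t, z) : ℝ × EuclideanSpace ℝ (Fin 3))) =
        Torus.lift (u t) := by
      funext z; rfl
    rw [hcomp] at h3
    have hslice : Torus.IsContDiff 1 (u t) := (hC2 t ht).of_le (by norm_num)
    rw [Torus.partialDeriv, Torus.lineDeriv_eq_fderiv_apply hslice, ← Torus.fderiv_lift, h3.fderiv]
    rfl
  -- uniform bounds on `[0,T] × 𝕋³`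
  have hbd : ∀ i : Fin 3, ∃ C : ℝ, ∀ t ∈ Icc 0 T, ∀ x, ‖Torus.partialDeriv i (u t) x‖ ≤ C := by
    intro i
    have hG : ContinuousOn (fun z => fderivWithin ℝ (Torus.stLift u) S z (0, EuclideanSpace.single i 1)) S :=
      (hC1.continuousOn_fderivWithin hSU le_rfl).clm_apply continuousOn_const
    have hcont : ContinuousOn (Torus.stLift (fun t x => Torus.partialDeriv i (u t) x)) S := by
      refine hG.congr fun z hz => ?_
      obtain ⟨t, y⟩ := z
      rw [Torus.stLift_apply]
      exact hpd i t (mem_prod.1 hz).1 y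
    exact Torus.exists_norm_le_of_continuousOn_of_isCompact hcont isCompact_Icc Subset.rfl
  choose C hC using hbd
  refine ⟨∑ i, C i ^ 2, fun t ht => ?_⟩
  unfold Torus.gradNormSq
  calc ∫ x, ∑ i, ‖Torus.partialDeriv i (u t) x‖ ^ 2 ∂volume
        ≤ ∫ _x, ∑ i, C i ^ 2 ∂(volume : Measure (UnitAddTorus (Fin 3))) := by
          refine integral_mono_of_nonneg (ae_of_all _ fun x => Finset.sum_nonneg fun i _ => sq_nonneg _)
            (integrable_const _) (ae_of_all _ fun x => Finset.sum_le_sum fun i _ => ?_)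
          exact pow_le_pow_left₀ (norm_nonneg _) (hC i t ht x) 2
    _ = ∑ i, C i ^ 2 := by simp

/-! ### Classical solutions are in the class, after renormalising the pressure -/

/-- A classical (smooth) solution of the unforced equations at viscosity `1` on `[0,T*) × 𝕋³`, restricted to
`[0,T']`, `0 < T' < T*`, with its pressure shifted by the time-dependent constant making `∫p = 1`, is a
`C¹ₜC²ₓ` solution of (2.1)–(2.5) with `Q₀ = 1`, `f ≡ 0`. [cite: Davlatov2016NSPeriodic, Definition 1 pp. 5–6] -/
theorem isC1C2Solution_of_classical {Tstar T' : ℝ} {u₀ : UnitAddTorus (Fin 3) → EuclideanSpace ℝ (Fin 3)}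
    {W : ℝ → UnitAddTorus (Fin 3) → EuclideanSpace ℝ (Fin 3)} {P : ℝ → UnitAddTorus (Fin 3) → ℝ}
    (hT' : 0 < T') (hlt : T' < Tstar) (hW : Torus.IsClassicalNSSolutionOn (Ico 0 Tstar) 1 0 W P)
    (hW0 : W 0 = u₀) :
    IsC1C2Solution T' 1 0 u₀ W
      (fun t x => P t x - ((∫ y, P t y ∂(volume : Measure (UnitAddTorus (Fin 3)))) - 1)) := by
  have hsub : Icc 0 T' ⊆ Ico 0 Tstar := Icc_subset_Ico_right hlt
  have hu : Torus.IsSmoothSpaceTimeOn (Ico 0 Tstar) W := hW.smooth_velocity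
  have hp : Torus.IsSmoothSpaceTimeOn (Ico 0 Tstar) P := hW.smooth_pressure
  set c : ℝ → ℝ := fun t => (∫ y, P t y ∂(volume : Measure (UnitAddTorus (Fin 3)))) - 1 with hc
  refine ⟨?_, ?_, ?_, ?_, ?_, fun t ht => hW.divFree t (hsub ht), hW0, ?_⟩
  · exact (hu.of_le (by simp)).mono (prod_mono hsub Subset.rfl)
  · intro t ht
    exact (hu.isSmooth_slice (hsub ht)).isContDiff (n := 2) (WithTop.coe_le_coe.mpr le_top)
  · have hpc : ContinuousOn (Torus.stLift P) (Icc 0 T' ×ˢ univ) :=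
      hp.continuousOn.mono (prod_mono hsub Subset.rfl)
    have hcc : ContinuousOn c (Icc 0 T') :=
      ((hp.continuousOn_integral (convex_Ico 0 Tstar)).mono hsub).sub continuousOn_const
    have hfun : Torus.stLift (fun t x => P t x - c t) =
        fun z : ℝ × EuclideanSpace ℝ (Fin 3) => Torus.stLift P z - c z.1 := by
      funext z; obtain ⟨t, y⟩ := z; rfl
    rw [hfun]
    exact hpc.sub (hcc.comp continuousOn_fst fun z hz => (mem_prod.1 hz).1)
  · intro t ht
    have h1 : ContDiff ℝ 1 (Torus.lift (P t)) :=
      (hp.isSmooth_slice (hsub ht)).isContDiff (n := 1) (WithTop.coe_le_coe.mpr le_top)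
    have hfun : Torus.lift (fun x => P t x - c t) = fun y => Torus.lift (P t) y - c t := rfl
    show ContDiff ℝ 1 (Torus.lift (fun x => P t x - c t))
    rw [hfun]
    exact h1.sub contDiff_const
  · intro t ht x
    have hmom := hW.momentum t (hsub ht) x
    have htd : Torus.timeDerivWithin (Icc 0 T') W t x = Torus.timeDerivWithin (Ico 0 Tstar) W t x := by
      obtain ⟨y, rfl⟩ := Torus.proj_surjective x
      simp only [Torus.timeDerivWithin]
      refine derivWithin_subset hsub (uniqueDiffOn_Icc hT' t ht) ?_
      have hd : DifferentiableWithinAt ℝ (Torus.stLift W) (Ico 0 Tstar ×ˢ univ) (t, y) :=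
        hu.differentiableOn (by simp) (t, y) (mk_mem_prod (hsub ht) (mem_univ _))
      exact hd.comp t (differentiableWithinAt_id.prodMk (differentiableWithinAt_const y))
        (fun s hs => mk_mem_prod hs (mem_univ _))
    have hgrad : Torus.gradient (fun x => P t x - c t) x = Torus.gradient (P t) x := by
      simp only [Torus.gradient]
      have hla : Torus.liftAt (fun x => P t x - c t) x = fun v => Torus.liftAt (P t) x v - c t := by
        funext v; simp [Torus.liftAt_apply]
      rw [hla]
      unfold gradient
      rw [fderiv_sub_const]
    show Torus.timeDerivWithin (Icc 0 T') W t x + Torus.convect (W t) (W t) x =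
      Torus.laplacian (W t) x - Torus.gradient (fun x => P t x - c t) x +
        (0 : ℝ → UnitAddTorus (Fin 3) → EuclideanSpace ℝ (Fin 3)) t x
    rw [htd, hgrad, hmom, one_smul]
  · intro t ht
    have hint : Integrable (P t) (volume : Measure (UnitAddTorus (Fin 3))) :=
      (hp.isSmooth_slice (hsub ht)).integrable
    show ∫ x, (P t x - c t) ∂(volume : Measure (UnitAddTorus (Fin 3))) = 1
    rw [integral_sub hint (integrable_const _), integral_const]
    simp [hc]

/-! ### The bridge -/

/-- The divergence of a constant multiple: `c u₀` is divergence free if `u₀` is. [folklore] -/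
private theorem isDivFree_const_smul {u₀ : EuclideanSpace ℝ (Fin 3) → EuclideanSpace ℝ (Fin 3)}
    (hsm : ContDiff ℝ 1 u₀) (hdiv : NSWave0.IsDivFree u₀) (c : ℝ) :
    NSWave0.IsDivFree (fun x => c • u₀ x) := by
  intro x
  have hd : DifferentiableAt ℝ u₀ x := (hsm.differentiable one_ne_zero) x
  show LinearMap.trace ℝ _ (fderiv ℝ (fun x => c • u₀ x) x : EuclideanSpace ℝ (Fin 3) →ₗ[ℝ] EuclideanSpace ℝ (Fin 3)) = 0
  rw [fderiv_fun_const_smul hd, ContinuousLinearMap.toLinearMap_smul, map_smul]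
  have := hdiv x
  unfold NSWave0.divergence at this
  rw [this, smul_zero]

/-- **`ClayDelta` HOLDS** — the classical bridge «unique global `C¹ₜC²ₓ` solvability on `𝕋³` from the
transported datum ⇒ Clay (B) solvability», proved by the maximal smooth solution and the blow-up
alternative (RRS 2016 §6.3/§8.1), using the hypothesis only through its uniqueness clause; the `C^∞`
bootstrap axis Δ5 is thereby avoided. [cite: FeffermanClay2006, (B) with (8) (10) (11), p. 2]
[cite: RobinsonRodrigoSadowskiCUP2016, §6.3 p. 108 and §8.1 p. 122] -/
theorem clayDelta_holds : Literature.Claims.NS.Davlatov2020.ClayDelta := by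
  intro ν hν u₀ hsm hdiv hper
  have hd : Fintype.card (Fin 3) = 3 := by simp
  -- the `ν`-normalised periodic datum and its descent to the torus
  set g : EuclideanSpace ℝ (Fin 3) → EuclideanSpace ℝ (Fin 3) := fun x => ν⁻¹ • u₀ x with hg
  have hgper : FluidPDE.IsLatticePeriodic g := fun j x => by
    simp only [hg, hper j x]
  have hgsm : ContDiff ℝ ((⊤ : ℕ∞) : WithTop ℕ∞) g := hsm.const_smul ν⁻¹
  have hgdiv : NSWave0.IsDivFree g := isDivFree_const_smul (hsm.of_le (mod_cast le_top)) hdiv ν⁻¹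
  set V₀ : UnitAddTorus (Fin 3) → EuclideanSpace ℝ (Fin 3) := Torus.descend g hgper with hV₀
  have hlift : Torus.lift V₀ = g := Torus.lift_descend_holds g hgper
  have hV₀s : Torus.IsSmooth V₀ := by
    show ContDiff ℝ ∞ (Torus.lift V₀)
    rw [hlift]
    exact hgsm
  have hV₀d : Torus.IsDivFree V₀ := (isDivFree_lift_iff_torus hV₀s).1 (by rw [hlift]; exact hgdiv)
  have hV₀H4 : InH4capV1 V₀ :=
    ⟨Torus.IsSmooth.memSobolev_holds hV₀s.complexify_comp 4,
      Torus.IsDivFree.isWeaklyDivFree Torus.integral_inner_gradient_eq_neg_integral_mul_divergence_holds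
        hV₀s hV₀d⟩
  refine ⟨V₀, hV₀H4, fun H => ?_⟩
  -- Clay side: solvability at viscosity `1` for `ν⁻¹ u₀` gives solvability at viscosity `ν` for `u₀`
  suffices hsolv : clayPeriodic.Solvable 1 0 g by
    have hadm : ∀ (v : ℝ → EuclideanSpace ℝ (Fin 3) → EuclideanSpace ℝ (Fin 3))
        (q : ℝ → EuclideanSpace ℝ (Fin 3) → ℝ),
        clayPeriodic.admissible v q → clayPeriodic.admissible (timeRescale ν ν v) (timeRescale ν (ν ^ 2) q) := by
      intro v q hv t ht j x
      simp only [timeRescale_apply]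
      rw [hv (ν * t) (by positivity) j x]
    have h2 := ClaySpec.Solvable.of_viscosity (S := clayPeriodic) (μ := 1) (a := ν) hν hadm
      (g := 0) (u₀ := u₀) (by simpa only [hg] using hsolv)
    have h0 : timeRescale ν (ν ^ 2) (0 : ℝ → EuclideanSpace ℝ (Fin 3) → EuclideanSpace ℝ (Fin 3)) = 0 := by
      funext s x; simp [timeRescale]
    rw [mul_one, h0] at h2
    exact h2
  -- the maximal classical solution on the torus at viscosity `1`
  obtain ⟨W, P, hW0, hcases⟩ := Torus.exists_maximal_classicalNS_anyMean hd one_pos hV₀s hV₀d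
  rcases hcases with ⟨hW, -⟩ | ⟨Tstar, hTstar, hW, hnotbdd, -⟩
  · exact (clayPeriodic_solvable_zero_iff_torus 1 hgper).2 ⟨W, P, hW, by rw [hW0, hlift]⟩
  · exfalso
    -- the hypothesis at the maximal time: a `C¹ₜC²ₓ` solution on `[0, T*]`
    obtain ⟨⟨u, p, hup⟩, -⟩ := H Tstar hTstar
    obtain ⟨B, hB⟩ := gradNormSq_le_of_isC1C2 hTstar hup
    refine hnotbdd ⟨B, ?_⟩
    rintro _ ⟨t, ht, rfl⟩
    have hWu : W t = u t := by
      rcases eq_or_lt_of_le ht.1 with h0 | htpos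
      · rw [← h0, hW0]
        exact hup.2.2.2.2.2.2.1.symm
      · obtain ⟨-, huniq⟩ := H t htpos
        exact (huniq W u _ p (isC1C2Solution_of_classical htpos ht.2 hW hW0)
          (isC1C2Solution_mono htpos ht.2.le hup) t ⟨htpos.le, le_rfl⟩).1
    show Torus.gradNormSq (W t) ≤ B
    rw [hWu]
    exact hB t ⟨ht.1, ht.2.le⟩

/-- **The row's Clay link, unconditional in the bridge**: Theorem 4's conclusion shape (unique global
`C¹ₜC²ₓ` solvability for `H⁴ ∩ V₁` data, zero force, `Q₀ = 1`) implies Clay (B) — `ClayDelta` discharged.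
[cite: FeffermanClay2006, (B) p. 2] -/
theorem clayPeriodic_of_theorem4Shape
    (h4 : ∀ v₀ : UnitAddTorus (Fin 3) → EuclideanSpace ℝ (Fin 3), InH4capV1 v₀ →
      ∀ T : ℝ, 0 < T →
        (∃ (u : ℝ → UnitAddTorus (Fin 3) → EuclideanSpace ℝ (Fin 3)) (p : ℝ → UnitAddTorus (Fin 3) → ℝ),
            IsC1C2Solution T 1 0 v₀ u p) ∧
          ∀ (u v : ℝ → UnitAddTorus (Fin 3) → EuclideanSpace ℝ (Fin 3)) (p q : ℝ → UnitAddTorus (Fin 3) → ℝ),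
            IsC1C2Solution T 1 0 v₀ u p → IsC1C2Solution T 1 0 v₀ v q →
              ∀ t ∈ Icc 0 T, u t = v t ∧ p t = q t) :
    ∀ ν : ℝ, 0 < ν → clayPeriodic.RegularityAt ν := by
  intro ν hν u₀ hs hdiv hper
  obtain ⟨v₀, hv₀, himp⟩ := clayDelta_holds ν hν u₀ hs hdiv hper
  exact himp (h4 v₀ hv₀)

end Davlatov2020

end Summit.NavierStokesRegularity.NavierStokesRegularity.Theorems
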